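import Summits.QuantumFields.BalabanUV.Beta.EriceRemainderEnclosureHistoryAutonomyTelescoping

/-!
# EriceRemainderEnclosureHistoryAutonomyDiscrepancy — (E43a) THE DISCREPANCY OF TWO BOX SOLUTIONS IS BOUNDED: for ANY functional with a
# zeroth moment `M` and a floor `b > 0` on ]0,γ], two box solutions `h, h′` of its flow with memory from one pin have recursion variables
# with `|1∕h_m² − 1∕h′_m²| ≤ 10M³∕(b³√b)` at EVERY scale — a three-round bootstrap through the asymptotic-freedom envelope (`|h−h′| ≤ (mb)^{−1∕2}`
# ⟹ `|D| ≲ √m` ⟹ `|h−h′| ≲ 1∕m` ⟹ `|D| ≲ ⁴√m` ⟹ `|h−h′| ≲ m^{−5∕4}`, summable) with the telescoping sums of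
# `…HistoryAutonomyTelescoping` and node U2's `T4OneLoopAsymptotics.sum_inv_sqrt_succ_le` ∕ `T4TwoLoopLaw.sum_inv_mul_sqrt_succ_le`; the input of (E43b) `…HistoryAutonomyMonotoneGeneral` (monotone memory of ANY
# size has unique box solutions) and of its non-merging lemma

Cell `pub-balaban`, β-function sub-cell, BINDER row D4 «RemainderConst leaves for Bałaban's split» (`HOME/BINDER-OWNERS.md`; owner
lineage `b2b-balaban-beta-an4`; this file by co-owner #2 lineage `b2b-balaban-beta-d4-p2`, generation 40), β-FLOW TEAM duty (1),
FREEZE (0) honoured (def-free; node U2's `MemFlow` ∕ `memFlow_sq_le` ∕ `Sharpness.abs_sub_le_half_cube_mul`, (E38a)'s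
`abs_sub_le_invSqrt_of_memFlow` ∕ `le_inv_sqrt_of_le_inv_sq` BY NAME).  Imports `…HistoryAutonomyTelescoping` (hence (E38a)).

HONEST FRAMING (page 1, verbatim and binding).  *"Discharging BetaPertH makes Bałaban's UV stability UNCONDITIONAL — a real
constructive-QFT result; it is NOT the continuum limit and NOT the Clay problem."*  THIS FILE DISCHARGES NOTHING OF THE KIND.  Pure real
analysis about an ABSTRACT functional with displayed zeroth moment and floor; nothing of Bałaban's (1.22) asserted.  Row D4 class
UNCHANGED (critical-path width 0; instance 0∕1; D4 DISCHARGE NO DATE).  HONEST DEPENDENCY: continuum YM on T⁴ ⇐ BetaPertH ∧ nine spine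
estimates (0/9 proved); BetaPertH ⇐ (D1) ∧ (D4) ∧ CAP+tail; G-an2-4 gates asym, D1 and NE2/3/4.

WHAT IS PROVED ([folklore]; 0 `def`, 0 sorry).  §2 `abs_disc_succ_sub_le` (one increment = one memory term), `abs_disc_le_sum`, `abs_sub_le_inv_sqrt` (crude
envelope), `abs_sub_le_half_cube_disc`, `inv_sqrt_cube_le`, `sum_eps_le`.  §3 the bootstrap `abs_disc_le_round0` (`≤ 2M√m∕√b`),
`abs_sub_le_round1` (`≤ M∕(b²m)`), `abs_disc_le_round1` (`≤ 4M²⁴√m∕b²`), `abs_sub_le_round2` (`≤ 2M²∕(b³√b)·m^{−5∕4}`), **`abs_disc_le_K`**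
(`|1∕h_m² − 1∕h′_m²| ≤ 10M³∕(b³√b)`).
-/

noncomputable section
open Filter Topology Finset

namespace Summit.QuantumFields.BalabanUV.Beta.EriceRemainderEnclosureHistoryAutonomyDiscrepancy

open Literature.MathematicalPhysics.QuantumFieldTheory.Balaban1983to89
open Literature.MathematicalPhysics.QuantumFieldTheory.Balaban1983to89.T4BetaStationary
open Literature.MathematicalPhysics.QuantumFieldTheory.Balaban1983to89.T4BetaFlowWellPosed
open Literature.MathematicalPhysics.QuantumFieldTheory.Balaban1983to89.T4BetaFlowWellPosed.Sharpness (abs_sub_le_half_cube_mul)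
open Summit.QuantumFields.BalabanUV.Beta.EriceRemainderEnclosureHistoryAutonomyWellPosed
open Summit.QuantumFields.BalabanUV.Beta.EriceRemainderEnclosureHistoryAutonomyThreshold
open Summit.QuantumFields.BalabanUV.Beta.EriceRemainderEnclosureHistoryAutonomyTelescoping
open Literature.MathematicalPhysics.QuantumFieldTheory.Balaban1983to89.T4OneLoopAsymptotics (sum_inv_sqrt_succ_le)
open Literature.MathematicalPhysics.QuantumFieldTheory.Balaban1983to89.T4TwoLoopLaw (sum_inv_mul_sqrt_succ_le)

variable {B : (ℕ → ℝ) → ℝ} {M γ b gIR : ℝ} {h h' : ℕ → ℝ}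

/-! ## §2 The discrepancy of two box solutions: increments, the crude envelope, the half-cube sensitivity -/

/-- THE INCREMENT of the discrepancy `D_m = 1∕h_m² − 1∕h′_m²` is one memory term: `D_{m+1} − D_m = B(h(m+1+·)) − B(h′(m+1+·))`, hence
`|D_{m+1} − D_m| ≤ M·η` whenever the two shifted histories are entrywise `η`-close. [folklore] -/
theorem abs_disc_succ_sub_le
    (hB : ∀ u u' : ℕ → ℝ, SeqBox γ u → SeqBox γ u' → ∀ D : ℝ, (∀ j, |u j - u' j| ≤ D) → |B u - B u'| ≤ M * D)
    (hh : SeqBox γ h) (hh' : SeqBox γ h') (hf : MemFlow B gIR h) (hf' : MemFlow B gIR h') (m : ℕ) {η : ℝ}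
    (hη : ∀ j, |h (m + 1 + j) - h' (m + 1 + j)| ≤ η) :
    |(1 / h (m + 1) ^ 2 - 1 / h' (m + 1) ^ 2) - (1 / h m ^ 2 - 1 / h' m ^ 2)| ≤ M * η := by
  rw [hf.2 m, hf'.2 m, show 1 / h m ^ 2 + B (fun j => h (m + 1 + j)) - (1 / h' m ^ 2 + B fun j => h' (m + 1 + j))
      - (1 / h m ^ 2 - 1 / h' m ^ 2) = B (fun j => h (m + 1 + j)) - B (fun j => h' (m + 1 + j)) by ring]
  exact hB _ _ (seqBox_shift hh (m + 1)) (seqBox_shift hh' (m + 1)) η hη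

/-- TELESCOPING: `|D_m| ≤ Σ_{l<m} |D_{l+1} − D_l|` (`D_0 = 0`). [folklore] -/
theorem abs_disc_le_sum (hf : MemFlow B gIR h) (hf' : MemFlow B gIR h') (m : ℕ) :
    |1 / h m ^ 2 - 1 / h' m ^ 2|
      ≤ ∑ l ∈ range m, |(1 / h (l + 1) ^ 2 - 1 / h' (l + 1) ^ 2) - (1 / h l ^ 2 - 1 / h' l ^ 2)| := by
  have e : 1 / h m ^ 2 - 1 / h' m ^ 2
      = ∑ l ∈ range m, ((1 / h (l + 1) ^ 2 - 1 / h' (l + 1) ^ 2) - (1 / h l ^ 2 - 1 / h' l ^ 2)) := by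
    rw [Finset.sum_range_sub (fun l => 1 / h l ^ 2 - 1 / h' l ^ 2) m, hf.1, hf'.1, sub_self, sub_zero]
  rw [e]
  exact abs_sum_le_sum_abs _ _

/-- THE CRUDE ENVELOPE: `|h (i+1) − h′ (i+1)| ≤ 1∕√((i+1)·b)` — both values lie in ]0, (1∕gIR² + (i+1)b)^{−1∕2}]. [folklore] -/
theorem abs_sub_le_inv_sqrt (hb : 0 < b) (hgIR : 0 < gIR) (hlo : ∀ u, SeqBox γ u → b ≤ B u)
    (hh : SeqBox γ h) (hh' : SeqBox γ h') (hf : MemFlow B gIR h) (hf' : MemFlow B gIR h') (i : ℕ) :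
    |h (i + 1) - h' (i + 1)| ≤ 1 / Real.sqrt (((i : ℝ) + 1) * b) := by
  have h1 := abs_sub_le_invSqrt_of_memFlow hb hgIR hlo hlo hh hh' hf hf' (i + 1)
  push_cast at h1
  exact h1.trans (one_div_sqrt_anti (by positivity) (le_add_of_nonneg_left (by positivity)))

/-- THE HALF-CUBE SENSITIVITY along the run: `|h i − h′ i| ≤ (c_i³∕2)·|D_i|`, `c_i = (1∕gIR² + i·b)^{−1∕2}`. [folklore] -/
theorem abs_sub_le_half_cube_disc (hb : 0 < b) (hgIR : 0 < gIR) (hlo : ∀ u, SeqBox γ u → b ≤ B u)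
    (hh : SeqBox γ h) (hh' : SeqBox γ h') (hf : MemFlow B gIR h) (hf' : MemFlow B gIR h') (i : ℕ) :
    |h i - h' i| ≤ (1 / Real.sqrt (1 / gIR ^ 2 + (i : ℝ) * b)) ^ 3 / 2 * |1 / h i ^ 2 - 1 / h' i ^ 2| := by
  have hP0 : 0 < 1 / gIR ^ 2 + (i : ℝ) * b := by
    have : (0 : ℝ) ≤ (i : ℝ) * b := mul_nonneg (Nat.cast_nonneg i) hb.le
    positivity
  have e : ∀ {u : ℕ → ℝ}, SeqBox γ u → MemFlow B gIR u → u i ≤ 1 / Real.sqrt (1 / gIR ^ 2 + (i : ℝ) * b) := by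
    intro u hu hfu
    have h2 := memFlow_sq_le hlo hb hgIR hu hfu i
    have h3 : 1 / gIR ^ 2 + (i : ℝ) * b ≤ 1 / u i ^ 2 := by
      have := one_div_le_one_div_of_le (pow_pos (hu i).1 2) h2
      rwa [one_div_one_div] at this
    exact le_inv_sqrt_of_le_inv_sq (hu i).1 hP0 h3
  exact abs_sub_le_half_cube_mul (hh i).1 (hh' i).1 (e hh hf) (e hh' hf')

/-- The half-cube weight against the index: `(1∕√(1∕gIR² + i·b))³ ≤ 1∕((i·b)·√(i·b))` for `i ≥ 1`... stated at `i+1`: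
`(1∕√(1∕gIR² + (i+1)b))³ ≤ 1∕(b√b · ((i+1)√(i+1)))`. [folklore] -/
theorem inv_sqrt_cube_le (hb : 0 < b) (gIR : ℝ) (i : ℕ) :
    (1 / Real.sqrt (1 / gIR ^ 2 + ((i : ℝ) + 1) * b)) ^ 3
      ≤ 1 / (b * Real.sqrt b * (((i : ℝ) + 1) * Real.sqrt ((i : ℝ) + 1))) := by
  have hib : 0 < ((i : ℝ) + 1) * b := by positivity
  have h1 : 1 / Real.sqrt (1 / gIR ^ 2 + ((i : ℝ) + 1) * b) ≤ 1 / Real.sqrt (((i : ℝ) + 1) * b) :=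
    one_div_sqrt_anti hib (le_add_of_nonneg_left (by positivity))
  have h0 : 0 ≤ 1 / Real.sqrt (1 / gIR ^ 2 + ((i : ℝ) + 1) * b) := by positivity
  refine (pow_le_pow_left₀ h0 h1 3).trans (le_of_eq ?_)
  have hs2 : Real.sqrt ((i : ℝ) + 1) ^ 2 = (i : ℝ) + 1 := Real.sq_sqrt (by positivity)
  have ht2 : Real.sqrt b ^ 2 = b := Real.sq_sqrt hb.le
  rw [Real.sqrt_mul' _ hb.le, div_pow, one_pow, mul_pow,
    show Real.sqrt ((i : ℝ) + 1) ^ 3 = ((i : ℝ) + 1) * Real.sqrt ((i : ℝ) + 1) by rw [pow_succ, hs2],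
    show Real.sqrt b ^ 3 = b * Real.sqrt b by rw [pow_succ, ht2]]
  ring

/-- The whole-range weight sum `Σ_{l<N} (c_{l+1}³∕2)·M ≤ 3M∕(2b√b)` in the form used below. [folklore] -/
theorem sum_eps_le (hb : 0 < b) (hM : 0 ≤ M) (gIR : ℝ) (N : ℕ) :
    ∑ l ∈ range N, M / 2 * (1 / Real.sqrt (1 / gIR ^ 2 + ((l : ℝ) + 1) * b)) ^ 3 ≤ 3 * M / (2 * (b * Real.sqrt b)) := by
  calc ∑ l ∈ range N, M / 2 * (1 / Real.sqrt (1 / gIR ^ 2 + ((l : ℝ) + 1) * b)) ^ 3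
      ≤ ∑ l ∈ range N, M / 2 * (1 / (b * Real.sqrt b * (((l : ℝ) + 1) * Real.sqrt ((l : ℝ) + 1)))) :=
        sum_le_sum fun l _ => mul_le_mul_of_nonneg_left (inv_sqrt_cube_le hb gIR l) (by positivity)
    _ = M / 2 * (1 / (b * Real.sqrt b)) * ∑ l ∈ range N, 1 / (((l : ℝ) + 1) * Real.sqrt ((l : ℝ) + 1)) := by
        rw [mul_sum]; exact sum_congr rfl fun l _ => by rw [← one_div_mul_one_div]; ring
    _ ≤ M / 2 * (1 / (b * Real.sqrt b)) * 3 :=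
        mul_le_mul_of_nonneg_left (sum_inv_mul_sqrt_succ_le N) (by positivity)
    _ = 3 * M / (2 * (b * Real.sqrt b)) := by ring

/-! ## §3 The bootstrap: the discrepancy of the recursion variables is BOUNDED, `|D_m| ≤ 10M³∕(b³√b)` -/

/-- ROUND 0: `|D_m| ≤ 2M√m∕√b` (the crude envelope `|h − h′| ≤ 1∕√(jb)` summed). [folklore] -/
theorem abs_disc_le_round0
    (hB : ∀ u u' : ℕ → ℝ, SeqBox γ u → SeqBox γ u' → ∀ D : ℝ, (∀ j, |u j - u' j| ≤ D) → |B u - B u'| ≤ M * D)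
    (hM : 0 ≤ M) (hb : 0 < b) (hgIR : 0 < gIR) (hlo : ∀ u, SeqBox γ u → b ≤ B u)
    (hh : SeqBox γ h) (hh' : SeqBox γ h') (hf : MemFlow B gIR h) (hf' : MemFlow B gIR h') (m : ℕ) :
    |1 / h m ^ 2 - 1 / h' m ^ 2| ≤ 2 * M * Real.sqrt (m : ℝ) / Real.sqrt b := by
  have hsb : 0 < Real.sqrt b := Real.sqrt_pos.2 hb
  have hstep : ∀ l, |(1 / h (l + 1) ^ 2 - 1 / h' (l + 1) ^ 2) - (1 / h l ^ 2 - 1 / h' l ^ 2)|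
      ≤ M * (1 / Real.sqrt b * (1 / Real.sqrt ((l : ℝ) + 1))) := by
    intro l
    refine abs_disc_succ_sub_le hB hh hh' hf hf' l fun j => ?_
    have h1 := abs_sub_le_inv_sqrt hb hgIR hlo hh hh' hf hf' (l + j)
    rw [show l + j + 1 = l + 1 + j by ring] at h1
    refine h1.trans ?_
    rw [Real.sqrt_mul' _ hb.le, ← one_div_mul_one_div, mul_comm]
    refine mul_le_mul_of_nonneg_left (one_div_sqrt_anti (by positivity) ?_) (by positivity)
    push_cast; linarith
  calc |1 / h m ^ 2 - 1 / h' m ^ 2|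
      ≤ ∑ l ∈ range m, |(1 / h (l + 1) ^ 2 - 1 / h' (l + 1) ^ 2) - (1 / h l ^ 2 - 1 / h' l ^ 2)| :=
        abs_disc_le_sum hf hf' m
    _ ≤ ∑ l ∈ range m, M * (1 / Real.sqrt b * (1 / Real.sqrt ((l : ℝ) + 1))) := sum_le_sum fun l _ => hstep l
    _ = M / Real.sqrt b * ∑ l ∈ range m, 1 / Real.sqrt ((l : ℝ) + 1) := by
        rw [mul_sum]; exact sum_congr rfl fun l _ => by ring
    _ ≤ M / Real.sqrt b * (2 * Real.sqrt (m : ℝ)) := mul_le_mul_of_nonneg_left (sum_inv_sqrt_succ_le m) (by positivity)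
    _ = 2 * M * Real.sqrt (m : ℝ) / Real.sqrt b := by ring

/-- ROUND 1, pointwise: `|h (i+1) − h′ (i+1)| ≤ M∕(b²·(i+1))`. [folklore] -/
theorem abs_sub_le_round1
    (hB : ∀ u u' : ℕ → ℝ, SeqBox γ u → SeqBox γ u' → ∀ D : ℝ, (∀ j, |u j - u' j| ≤ D) → |B u - B u'| ≤ M * D)
    (hM : 0 ≤ M) (hb : 0 < b) (hgIR : 0 < gIR) (hlo : ∀ u, SeqBox γ u → b ≤ B u)
    (hh : SeqBox γ h) (hh' : SeqBox γ h') (hf : MemFlow B gIR h) (hf' : MemFlow B gIR h') (i : ℕ) :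
    |h (i + 1) - h' (i + 1)| ≤ M / (b ^ 2 * ((i : ℝ) + 1)) := by
  have hsb : 0 < Real.sqrt b := Real.sqrt_pos.2 hb
  have hsi : 0 < Real.sqrt ((i : ℝ) + 1) := Real.sqrt_pos.2 (by positivity)
  have h1 := abs_sub_le_half_cube_disc hb hgIR hlo hh hh' hf hf' (i + 1)
  have h2 := abs_disc_le_round0 hB hM hb hgIR hlo hh hh' hf hf' (i + 1)
  have h3 := inv_sqrt_cube_le hb gIR i
  push_cast at h1 h2 h3
  calc |h (i + 1) - h' (i + 1)|
      ≤ (1 / Real.sqrt (1 / gIR ^ 2 + ((i : ℝ) + 1) * b)) ^ 3 / 2 * |1 / h (i + 1) ^ 2 - 1 / h' (i + 1) ^ 2| := h1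
    _ ≤ (1 / (b * Real.sqrt b * (((i : ℝ) + 1) * Real.sqrt ((i : ℝ) + 1)))) / 2
          * (2 * M * Real.sqrt ((i : ℝ) + 1) / Real.sqrt b) :=
        mul_le_mul (div_le_div_of_nonneg_right h3 (by norm_num)) h2 (abs_nonneg _) (by positivity)
    _ = M / (b ^ 2 * ((i : ℝ) + 1)) := by
        field_simp
        rw [show Real.sqrt b ^ 2 = b from Real.sq_sqrt hb.le]

/-- ROUND 1, summed: `|D_m| ≤ 4M²·⁴√m∕b²` (`Σ 1∕l ≤ Σ l^{−3∕4} ≤ 4·⁴√m`). [folklore] -/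
theorem abs_disc_le_round1
    (hB : ∀ u u' : ℕ → ℝ, SeqBox γ u → SeqBox γ u' → ∀ D : ℝ, (∀ j, |u j - u' j| ≤ D) → |B u - B u'| ≤ M * D)
    (hM : 0 ≤ M) (hb : 0 < b) (hgIR : 0 < gIR) (hlo : ∀ u, SeqBox γ u → b ≤ B u)
    (hh : SeqBox γ h) (hh' : SeqBox γ h') (hf : MemFlow B gIR h) (hf' : MemFlow B gIR h') (m : ℕ) :
    |1 / h m ^ 2 - 1 / h' m ^ 2| ≤ 4 * M ^ 2 / b ^ 2 * Real.sqrt (Real.sqrt (m : ℝ)) := by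
  have hstep : ∀ l, |(1 / h (l + 1) ^ 2 - 1 / h' (l + 1) ^ 2) - (1 / h l ^ 2 - 1 / h' l ^ 2)|
      ≤ M * (M / b ^ 2 * (1 / Real.sqrt (Real.sqrt ((l : ℝ) + 1)) ^ 3)) := by
    intro l
    refine abs_disc_succ_sub_le hB hh hh' hf hf' l fun j => ?_
    have h1 := abs_sub_le_round1 hB hM hb hgIR hlo hh hh' hf hf' (l + j)
    rw [show l + j + 1 = l + 1 + j by ring] at h1
    refine h1.trans ?_
    -- M/(b²(l+j+1)) ≤ M/(b²(l+1)) ≤ (M/b²)·(1/q(l+1)³)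
    have hq0 : 0 < Real.sqrt (Real.sqrt ((l : ℝ) + 1)) := Real.sqrt_pos.2 (Real.sqrt_pos.2 (by positivity))
    have hq4 : Real.sqrt (Real.sqrt ((l : ℝ) + 1)) ^ 4 = (l : ℝ) + 1 :=
      (by rw [show (4 : ℕ) = 2 * 2 by norm_num, pow_mul, Real.sq_sqrt (Real.sqrt_nonneg _), Real.sq_sqrt (by positivity)])
    have hq1 : 1 ≤ Real.sqrt (Real.sqrt ((l : ℝ) + 1)) :=
      Real.one_le_sqrt.2 (Real.one_le_sqrt.2 (by have := (Nat.cast_nonneg l : (0 : ℝ) ≤ l); linarith))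
    have hle : 1 / ((l : ℝ) + 1) ≤ 1 / Real.sqrt (Real.sqrt ((l : ℝ) + 1)) ^ 3 := by
      have h34 : Real.sqrt (Real.sqrt ((l : ℝ) + 1)) ^ 3 ≤ (l : ℝ) + 1 :=
        calc Real.sqrt (Real.sqrt ((l : ℝ) + 1)) ^ 3 ≤ Real.sqrt (Real.sqrt ((l : ℝ) + 1)) ^ 4 :=
              pow_le_pow_right₀ hq1 (by norm_num)
          _ = (l : ℝ) + 1 := hq4
      exact one_div_le_one_div_of_le (pow_pos hq0 3) h34
    calc M / (b ^ 2 * (((l + j : ℕ) : ℝ) + 1)) ≤ M / (b ^ 2 * ((l : ℝ) + 1)) := by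
          refine div_le_div_of_nonneg_left hM (by positivity) (mul_le_mul_of_nonneg_left ?_ (by positivity))
          push_cast; linarith
      _ = M / b ^ 2 * (1 / ((l : ℝ) + 1)) := by field_simp
      _ ≤ M / b ^ 2 * (1 / Real.sqrt (Real.sqrt ((l : ℝ) + 1)) ^ 3) := mul_le_mul_of_nonneg_left hle (by positivity)
  calc |1 / h m ^ 2 - 1 / h' m ^ 2|
      ≤ ∑ l ∈ range m, |(1 / h (l + 1) ^ 2 - 1 / h' (l + 1) ^ 2) - (1 / h l ^ 2 - 1 / h' l ^ 2)| :=
        abs_disc_le_sum hf hf' m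
    _ ≤ ∑ l ∈ range m, M * (M / b ^ 2 * (1 / Real.sqrt (Real.sqrt ((l : ℝ) + 1)) ^ 3)) := sum_le_sum fun l _ => hstep l
    _ = M ^ 2 / b ^ 2 * ∑ l ∈ range m, 1 / Real.sqrt (Real.sqrt ((l : ℝ) + 1)) ^ 3 := by
        rw [mul_sum]; exact sum_congr rfl fun l _ => by ring
    _ ≤ M ^ 2 / b ^ 2 * (4 * Real.sqrt (Real.sqrt (m : ℝ))) := mul_le_mul_of_nonneg_left (sum_inv_qrt_cube_le m) (by positivity)
    _ = 4 * M ^ 2 / b ^ 2 * Real.sqrt (Real.sqrt (m : ℝ)) := by ring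

/-- ROUND 2, pointwise: `|h (i+1) − h′ (i+1)| ≤ (2M²∕(b³√b))·1∕((i+1)·⁴√(i+1))` — SUMMABLE. [folklore] -/
theorem abs_sub_le_round2
    (hB : ∀ u u' : ℕ → ℝ, SeqBox γ u → SeqBox γ u' → ∀ D : ℝ, (∀ j, |u j - u' j| ≤ D) → |B u - B u'| ≤ M * D)
    (hM : 0 ≤ M) (hb : 0 < b) (hgIR : 0 < gIR) (hlo : ∀ u, SeqBox γ u → b ≤ B u)
    (hh : SeqBox γ h) (hh' : SeqBox γ h') (hf : MemFlow B gIR h) (hf' : MemFlow B gIR h') (i : ℕ) :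
    |h (i + 1) - h' (i + 1)| ≤ 2 * M ^ 2 / (b ^ 3 * Real.sqrt b) * (1 / (((i : ℝ) + 1) * Real.sqrt (Real.sqrt ((i : ℝ) + 1)))) := by
  have hsb : 0 < Real.sqrt b := Real.sqrt_pos.2 hb
  set q := Real.sqrt (Real.sqrt ((i : ℝ) + 1)) with hq
  have hq0 : 0 < q := Real.sqrt_pos.2 (Real.sqrt_pos.2 (by positivity))
  have hq2 : q ^ 2 = Real.sqrt ((i : ℝ) + 1) := Real.sq_sqrt (Real.sqrt_nonneg _)
  have hq4 : q ^ 4 = (i : ℝ) + 1 :=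
    (by rw [show (4 : ℕ) = 2 * 2 by norm_num, pow_mul, Real.sq_sqrt (Real.sqrt_nonneg _), Real.sq_sqrt (by positivity)])
  have h1 := abs_sub_le_half_cube_disc hb hgIR hlo hh hh' hf hf' (i + 1)
  have h2 := abs_disc_le_round1 hB hM hb hgIR hlo hh hh' hf hf' (i + 1)
  have h3 := inv_sqrt_cube_le hb gIR i
  push_cast at h1 h2 h3
  calc |h (i + 1) - h' (i + 1)|
      ≤ (1 / Real.sqrt (1 / gIR ^ 2 + ((i : ℝ) + 1) * b)) ^ 3 / 2 * |1 / h (i + 1) ^ 2 - 1 / h' (i + 1) ^ 2| := h1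
    _ ≤ (1 / (b * Real.sqrt b * (((i : ℝ) + 1) * Real.sqrt ((i : ℝ) + 1)))) / 2 * (4 * M ^ 2 / b ^ 2 * q) :=
        mul_le_mul (div_le_div_of_nonneg_right h3 (by norm_num)) h2 (abs_nonneg _) (by positivity)
    _ = 2 * M ^ 2 / (b ^ 3 * Real.sqrt b) * (1 / (((i : ℝ) + 1) * q)) := by
        rw [← hq2]
        field_simp
        -- both sides polynomial in q with q⁴ = i+1
        nlinarith [hq4, hq0]

/-- **THE DISCREPANCY IS BOUNDED**: `|1∕h_m² − 1∕h′_m²| ≤ 10M³∕(b³√b)` for two box solutions of one flow (zeroth moment `M`, floor `b`) from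
one pin — three rounds of bootstrap through the asymptotic-freedom envelope. [folklore] -/
theorem abs_disc_le_K
    (hB : ∀ u u' : ℕ → ℝ, SeqBox γ u → SeqBox γ u' → ∀ D : ℝ, (∀ j, |u j - u' j| ≤ D) → |B u - B u'| ≤ M * D)
    (hM : 0 ≤ M) (hb : 0 < b) (hgIR : 0 < gIR) (hlo : ∀ u, SeqBox γ u → b ≤ B u)
    (hh : SeqBox γ h) (hh' : SeqBox γ h') (hf : MemFlow B gIR h) (hf' : MemFlow B gIR h') (m : ℕ) :
    |1 / h m ^ 2 - 1 / h' m ^ 2| ≤ 10 * M ^ 3 / (b ^ 3 * Real.sqrt b) := by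
  have hsb : 0 < Real.sqrt b := Real.sqrt_pos.2 hb
  set K₂ : ℝ := 2 * M ^ 2 / (b ^ 3 * Real.sqrt b) with hK₂
  have hK₂0 : 0 ≤ K₂ := by positivity
  have hstep : ∀ l, |(1 / h (l + 1) ^ 2 - 1 / h' (l + 1) ^ 2) - (1 / h l ^ 2 - 1 / h' l ^ 2)|
      ≤ M * (K₂ * (1 / (((l : ℝ) + 1) * Real.sqrt (Real.sqrt ((l : ℝ) + 1))))) := by
    intro l
    refine abs_disc_succ_sub_le hB hh hh' hf hf' l fun j => ?_
    have h1 := abs_sub_le_round2 hB hM hb hgIR hlo hh hh' hf hf' (l + j)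
    rw [show l + j + 1 = l + 1 + j by ring] at h1
    refine h1.trans (mul_le_mul_of_nonneg_left ?_ hK₂0)
    refine one_div_le_one_div_of_le (by positivity) (mul_le_mul ?_ (Real.sqrt_le_sqrt (Real.sqrt_le_sqrt ?_))
      (by positivity) (by positivity)) <;> push_cast <;> linarith
  have hsum : ∑ l ∈ range m, 1 / (((l : ℝ) + 1) * Real.sqrt (Real.sqrt ((l : ℝ) + 1))) ≤ 5 := by
    cases m with
    | zero => simp
    | succ m =>
      rw [sum_range_succ']
      have h0 : (1 : ℝ) / ((((0 : ℕ) : ℝ) + 1) * Real.sqrt (Real.sqrt (((0 : ℕ) : ℝ) + 1))) = 1 := by simp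
      have h4 := sum_inv_mul_qrt_le m
      have e : ∑ k ∈ range m, 1 / ((((k + 1 : ℕ) : ℝ) + 1) * Real.sqrt (Real.sqrt (((k + 1 : ℕ) : ℝ) + 1)))
          = ∑ l ∈ range m, 1 / (((l : ℝ) + 2) * Real.sqrt (Real.sqrt ((l : ℝ) + 2))) :=
        sum_congr rfl fun l _ => by push_cast; rw [show (l : ℝ) + 1 + 1 = (l : ℝ) + 2 by ring]
      rw [h0, e]
      linarith
  calc |1 / h m ^ 2 - 1 / h' m ^ 2|
      ≤ ∑ l ∈ range m, |(1 / h (l + 1) ^ 2 - 1 / h' (l + 1) ^ 2) - (1 / h l ^ 2 - 1 / h' l ^ 2)| :=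
        abs_disc_le_sum hf hf' m
    _ ≤ ∑ l ∈ range m, M * (K₂ * (1 / (((l : ℝ) + 1) * Real.sqrt (Real.sqrt ((l : ℝ) + 1))))) :=
        sum_le_sum fun l _ => hstep l
    _ = M * K₂ * ∑ l ∈ range m, 1 / (((l : ℝ) + 1) * Real.sqrt (Real.sqrt ((l : ℝ) + 1))) := by
        rw [mul_sum]; exact sum_congr rfl fun l _ => by ring
    _ ≤ M * K₂ * 5 := mul_le_mul_of_nonneg_left hsum (by positivity)
    _ = 10 * M ^ 3 / (b ^ 3 * Real.sqrt b) := by rw [hK₂]; ring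

end Summit.QuantumFields.BalabanUV.Beta.EriceRemainderEnclosureHistoryAutonomyDiscrepancy

end
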